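import Summits.BirchSwinnertonDyer.Rank1Residual.X1.UnrSeriesFirstUnitCoeff
import Summits.BirchSwinnertonDyer.Rank1Residual.X11b.RouteR1IntReceptacle
import Summits.BirchSwinnertonDyer.Rank1Residual.X11b.BDPRouteHsiehFrame
import HarnessLib

/-!
# `μ = 0` and `λ` as the FIRST UNIT COEFFICIENT in the WIDE receptacle `𝓞_{ℂ_p}⟦T⟧`, and the
# algebra "one divisibility after inverting `p` + equal first unit coefficients ⟹ equal ideals"
# over `𝓞_{ℂ_p}` (cell `bsd-eis`, seat `bsd-eis-cgshw` g7; THEOREMS ONLY; the `𝓞_{ℂ_p}⟦T⟧` twin of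
# `X1/UnrSeriesFirstUnitCoeff.lean`, p406792, asked for by planner RULING L9-a (r2) and k5-c4
# 02:57:39Z (3) for the ♭ road of crux 4 `BSDpOnCellC`, line b1, atom c3)

HONEST FRAMING (cell `bsd-eis`, run/shared/lean/pub/bsd-eis/): pure commutative algebra of the
receptacle `𝓞_{ℂ_p}⟦T⟧` (`PowerSeries 𝓞_ℂ_[p]`, Mathlib's valuation ring of `ℂ_p`) in which the
non-split road of record now reads the BDP `p`-adic `L`-function (k5-c4, `X2/NonsplitBDPExistsInt.lean`,
p418462: c3♭ = `NonsplitIMCEqOnTreeInt`). Everything here is PROVED; nothing about any curve is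
asserted; nothing booked. The ONE difference from the `R₀ = W(𝔽̄_p)` file: `𝓞_{ℂ_p}` is NOT a
discrete valuation ring (`‖y‖ < 1` does not give `y/p ∈ 𝓞_{ℂ_p}`), so the step "`F·G = p^k·L` with
`F` having a unit coefficient ⟹ `p^k ∣ G`" is proved not by peeling one `p` at a time modulo the
maximal ideal but by a GAUSS-NORM argument on coefficients (`norm_coeff_le_of_forall_norm_coeff_mul_le`:
if every coefficient of `F·G` has norm `≤ c` then so does every coefficient of `G` — take the least
index at which `‖G_j‖` exceeds a threshold just below `sup_j ‖G_j‖`, and read the coefficient of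
`F·G` at `a + j`; ultrametric domination).

* hypothesis shape "`μ = 0`, `λ = n`" (inline, no definition): `‖[Tⁿ]L‖ = 1 ∧ ∀ i < n, ‖[Tⁱ]L‖ < 1`.
* `firstUnitCoeffAt_mul` (indices add), `firstUnitCoeff_unique`, `exists_firstUnitCoeffAt_of_exists_le`,
  `exists_firstUnitCoeffAt_right`, `norm_coeff_le_of_forall_norm_coeff_mul_le` (Gauss),
  `exists_eq_C_mul_of_forall_norm_le` (division by a constant), `exists_mul_eq_of_mul_eq_C_pow_mul`,
  `span_singleton_eq_of_firstUnitCoeffAt`, **`span_singleton_eq_of_C_pow_mul_mem`** (`p^k·L ∈ (F)`,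
  first unit coefficients of `F` and `L` at the same index ⟹ `(F) = (L)` in `𝓞_{ℂ_p}⟦T⟧`).

References: [Washington1997] §7.1 Prop. 7.2; [BoschGuntzerRemmert1984] §5.1.2 (Gauss norm);
cell: planner RULING L9-a (r2), cgshw MEMO-8 §11.
-/

set_option autoImplicit false

noncomputable section

open scoped Classical

open PowerSeries
open Literature.NumberTheory.LFunctions.Dwork (norm_natCast_p_padicComplex mem_unitBall)

namespace Summit.BirchSwinnertonDyer.Rank1Residual.X2.CpIntSeries

variable {p : ℕ} [Fact p.Prime]

/-! ### Coefficients of `𝓞_{ℂ_p}⟦T⟧` read in `ℂ_p` -/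

/-- A finite sum of elements of `ℂ_p` of norm `< t` (`t > 0`) has norm `< t`. [folklore] -/
theorem norm_sum_lt {α : Type*} (s : Finset α) {g : α → ℂ_[p]} {t : ℝ} (ht : 0 < t)
    (h : ∀ a ∈ s, ‖g a‖ < t) : ‖∑ a ∈ s, g a‖ < t := by
  induction s using Finset.induction_on with
  | empty => rw [Finset.sum_empty, norm_zero]; exact ht
  | insert a s ha ih =>
    rw [Finset.sum_insert ha]
    exact (IsUltrametricDist.norm_add_le_max _ _).trans_lt
      (max_lt (h a (Finset.mem_insert_self a s)) (ih fun b hb => h b (Finset.mem_insert_of_mem hb)))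

/-- The `n`-th coefficient of a product in `𝓞_{ℂ_p}⟦T⟧`, read in `ℂ_p`. [folklore] -/
theorem coe_coeff_mul (F G : PowerSeries 𝓞_ℂ_[p]) (n : ℕ) :
    ((coeff n (F * G) : 𝓞_ℂ_[p]) : ℂ_[p]) =
      ∑ x ∈ Finset.HasAntidiagonal.antidiagonal n,
        ((coeff x.1 F : 𝓞_ℂ_[p]) : ℂ_[p]) * ((coeff x.2 G : 𝓞_ℂ_[p]) : ℂ_[p]) := by
  rw [PowerSeries.coeff_mul]
  push_cast
  rfl

/-- Every coefficient of `L ∈ 𝓞_{ℂ_p}⟦T⟧` has norm `≤ 1`. [folklore] -/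
theorem norm_coeff_le_one (L : PowerSeries 𝓞_ℂ_[p]) (n : ℕ) :
    ‖((coeff n L : 𝓞_ℂ_[p]) : ℂ_[p])‖ ≤ 1 :=
  X11b.R1.norm_coe_padicComplexInt_le_one p _

/-! ### First unit coefficient: Gauss's lemma for the index, uniqueness -/

/-- **Indices add**: if the first unit coefficient of `F` sits at `a` and that of `G` at `b`, then
that of `F · G` sits at `a + b`. [cite: Washington1997, §7.1] -/
theorem firstUnitCoeffAt_mul {F G : PowerSeries 𝓞_ℂ_[p]} {a b : ℕ}
    (hF : (‖((coeff a F : 𝓞_ℂ_[p]) : ℂ_[p])‖ = 1 ∧ ∀ i < a, ‖((coeff i F : 𝓞_ℂ_[p]) : ℂ_[p])‖ < 1))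
    (hG : (‖((coeff b G : 𝓞_ℂ_[p]) : ℂ_[p])‖ = 1 ∧ ∀ i < b, ‖((coeff i G : 𝓞_ℂ_[p]) : ℂ_[p])‖ < 1)) :
    (‖((coeff (a + b) (F * G) : 𝓞_ℂ_[p]) : ℂ_[p])‖ = 1 ∧
      ∀ i < a + b, ‖((coeff i (F * G) : 𝓞_ℂ_[p]) : ℂ_[p])‖ < 1) := by
  have hterm : ∀ i j : ℕ, i < a ∨ j < b →
      ‖((coeff i F : 𝓞_ℂ_[p]) : ℂ_[p]) * ((coeff j G : 𝓞_ℂ_[p]) : ℂ_[p])‖ < 1 := by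
    intro i j hij
    rw [norm_mul]
    rcases hij with hi | hj
    · calc ‖((coeff i F : 𝓞_ℂ_[p]) : ℂ_[p])‖ * ‖((coeff j G : 𝓞_ℂ_[p]) : ℂ_[p])‖
          ≤ ‖((coeff i F : 𝓞_ℂ_[p]) : ℂ_[p])‖ :=
            mul_le_of_le_one_right (norm_nonneg _) (norm_coeff_le_one G j)
        _ < 1 := hF.2 i hi
    · calc ‖((coeff i F : 𝓞_ℂ_[p]) : ℂ_[p])‖ * ‖((coeff j G : 𝓞_ℂ_[p]) : ℂ_[p])‖
          ≤ ‖((coeff j G : 𝓞_ℂ_[p]) : ℂ_[p])‖ :=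
            mul_le_of_le_one_left (norm_nonneg _) (norm_coeff_le_one F i)
        _ < 1 := hG.2 j hj
  refine ⟨?_, fun m hm ↦ ?_⟩
  · rw [coe_coeff_mul, ← Finset.add_sum_erase _ _
      (Finset.HasAntidiagonal.mem_antidiagonal.mpr rfl : (a, b) ∈ _)]
    have hmain : ‖((coeff a F : 𝓞_ℂ_[p]) : ℂ_[p]) * ((coeff b G : 𝓞_ℂ_[p]) : ℂ_[p])‖ = 1 := by
      rw [norm_mul, hF.1, hG.1, one_mul]
    have hrest : ‖∑ x ∈ (Finset.HasAntidiagonal.antidiagonal (a + b)).erase (a, b),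
        ((coeff x.1 F : 𝓞_ℂ_[p]) : ℂ_[p]) * ((coeff x.2 G : 𝓞_ℂ_[p]) : ℂ_[p])‖ < 1 := by
      refine norm_sum_lt _ one_pos fun x hx ↦ hterm x.1 x.2 ?_
      obtain ⟨hne, hx⟩ := Finset.mem_erase.mp hx
      rw [Finset.HasAntidiagonal.mem_antidiagonal] at hx
      by_contra hc
      push Not at hc
      exact hne (Prod.ext (by simp only; omega) (by simp only; omega))
    rw [IsUltrametricDist.norm_add_eq_max_of_norm_ne_norm (by rw [hmain]; exact hrest.ne'), hmain,
      max_eq_left hrest.le]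
  · rw [coe_coeff_mul]
    refine norm_sum_lt _ one_pos fun x hx ↦ hterm x.1 x.2 ?_
    rw [Finset.HasAntidiagonal.mem_antidiagonal] at hx
    by_contra hc
    push Not at hc
    omega

/-- The first unit coefficient index is well defined. [folklore] -/
theorem firstUnitCoeff_unique {L : PowerSeries 𝓞_ℂ_[p]} {m n : ℕ}
    (hm : (‖((coeff m L : 𝓞_ℂ_[p]) : ℂ_[p])‖ = 1 ∧ ∀ i < m, ‖((coeff i L : 𝓞_ℂ_[p]) : ℂ_[p])‖ < 1))
    (hn : (‖((coeff n L : 𝓞_ℂ_[p]) : ℂ_[p])‖ = 1 ∧ ∀ i < n, ‖((coeff i L : 𝓞_ℂ_[p]) : ℂ_[p])‖ < 1)) :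
    m = n := by
  by_contra h
  rcases Nat.lt_or_gt_of_ne h with h | h
  · exact (hn.2 m h).ne hm.1
  · exact (hm.2 n h).ne hn.1

/-- If the coefficients of `G` are not all of norm `< 1` up to index `N`, `G` has a first unit
coefficient at some index `≤ N`. [folklore] -/
theorem exists_firstUnitCoeffAt_of_exists_le {G : PowerSeries 𝓞_ℂ_[p]} {N : ℕ}
    (h : ∃ j ≤ N, ¬ ‖((coeff j G : 𝓞_ℂ_[p]) : ℂ_[p])‖ < 1) :
    ∃ b ≤ N, (‖((coeff b G : 𝓞_ℂ_[p]) : ℂ_[p])‖ = 1 ∧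
      ∀ i < b, ‖((coeff i G : 𝓞_ℂ_[p]) : ℂ_[p])‖ < 1) := by
  obtain ⟨j, hjN, hj⟩ := h
  have hex : ∃ b, ¬ ‖((coeff b G : 𝓞_ℂ_[p]) : ℂ_[p])‖ < 1 := ⟨j, hj⟩
  refine ⟨Nat.find hex, (Nat.find_min' hex hj).trans hjN, ?_, fun i hi ↦ ?_⟩
  · exact le_antisymm (norm_coeff_le_one G _) (not_lt.mp (Nat.find_spec hex))
  · exact not_not.mp (Nat.find_min hex hi)

/-- If `F` has its first unit coefficient at `a` and `F · G` has one at `n`, then `G` has one at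
some `b` with `a + b = n`. [cite: Washington1997, §7.1] -/
theorem exists_firstUnitCoeffAt_right {F G : PowerSeries 𝓞_ℂ_[p]} {a n : ℕ}
    (hF : (‖((coeff a F : 𝓞_ℂ_[p]) : ℂ_[p])‖ = 1 ∧ ∀ i < a, ‖((coeff i F : 𝓞_ℂ_[p]) : ℂ_[p])‖ < 1))
    (hFG : (‖((coeff n (F * G) : 𝓞_ℂ_[p]) : ℂ_[p])‖ = 1 ∧
      ∀ i < n, ‖((coeff i (F * G) : 𝓞_ℂ_[p]) : ℂ_[p])‖ < 1)) :
    ∃ b, (‖((coeff b G : 𝓞_ℂ_[p]) : ℂ_[p])‖ = 1 ∧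
      ∀ i < b, ‖((coeff i G : 𝓞_ℂ_[p]) : ℂ_[p])‖ < 1) ∧ a + b = n := by
  have h : ∃ j ≤ n, ¬ ‖((coeff j G : 𝓞_ℂ_[p]) : ℂ_[p])‖ < 1 := by
    by_contra hc
    push Not at hc
    -- then every coefficient of `F·G` of index `≤ n` has norm `< 1`
    have : ‖((coeff n (F * G) : 𝓞_ℂ_[p]) : ℂ_[p])‖ < 1 := by
      rw [coe_coeff_mul]
      refine norm_sum_lt _ one_pos fun x hx ↦ ?_
      rw [Finset.HasAntidiagonal.mem_antidiagonal] at hx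
      rw [norm_mul]
      calc ‖((coeff x.1 F : 𝓞_ℂ_[p]) : ℂ_[p])‖ * ‖((coeff x.2 G : 𝓞_ℂ_[p]) : ℂ_[p])‖
          ≤ ‖((coeff x.2 G : 𝓞_ℂ_[p]) : ℂ_[p])‖ :=
            mul_le_of_le_one_left (norm_nonneg _) (norm_coeff_le_one F x.1)
        _ < 1 := hc x.2 (by omega)
    exact this.ne hFG.1
  obtain ⟨b, -, hb⟩ := exists_firstUnitCoeffAt_of_exists_le h
  exact ⟨b, hb, firstUnitCoeff_unique (firstUnitCoeffAt_mul hF hb) hFG⟩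

/-! ### The Gauss-norm step (replaces the DVR peeling of the `R₀` file) -/

/-- **Gauss's lemma, coefficientwise**: if `F` has a unit coefficient (its first at `a`) and every
coefficient of `F · G` has norm `≤ c`, then every coefficient of `G` has norm `≤ c`. Proof: with
`s = sup_j ‖G_j‖`, `δ = max_{i<a} ‖F_i‖ < 1`, take the least `j` with `‖G_j‖ > max(c, δ·s)`; in the
coefficient of `F·G` at `a + j` the term `F_a G_j` strictly dominates all others (ultrametric), so
`‖(F·G)_{a+j}‖ = ‖G_j‖ > c`. [cite: BoschGuntzerRemmert1984, §5.1.2 Prop. 1 (Gauss norm is multiplicative)] -/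
theorem norm_coeff_le_of_forall_norm_coeff_mul_le {F G : PowerSeries 𝓞_ℂ_[p]} {a : ℕ} {c : ℝ}
    (hF : (‖((coeff a F : 𝓞_ℂ_[p]) : ℂ_[p])‖ = 1 ∧ ∀ i < a, ‖((coeff i F : 𝓞_ℂ_[p]) : ℂ_[p])‖ < 1))
    (hFG : ∀ m, ‖((coeff m (F * G) : 𝓞_ℂ_[p]) : ℂ_[p])‖ ≤ c) :
    ∀ j, ‖((coeff j G : 𝓞_ℂ_[p]) : ℂ_[p])‖ ≤ c := by
  -- notation
  set g : ℕ → ℝ := fun j ↦ ‖((coeff j G : 𝓞_ℂ_[p]) : ℂ_[p])‖ with hg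
  have hg0 : ∀ j, 0 ≤ g j := fun j ↦ norm_nonneg _
  have hg1 : ∀ j, g j ≤ 1 := fun j ↦ norm_coeff_le_one G j
  have hbdd : BddAbove (Set.range g) := ⟨1, by rintro _ ⟨j, rfl⟩; exact hg1 j⟩
  by_contra hcon
  push Not at hcon
  obtain ⟨j₁, hj₁⟩ := hcon
  have hc0 : 0 ≤ c := (norm_nonneg _).trans (hFG 0)
  -- the supremum `s` of the coefficient norms of `G`
  set s : ℝ := ⨆ j, g j with hs
  have hle_s : ∀ j, g j ≤ s := fun j ↦ le_ciSup hbdd j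
  have hcs : c < s := hj₁.trans_le (hle_s j₁)
  have hs0 : 0 < s := hc0.trans_lt hcs
  -- `δ = max_{i<a} ‖F_i‖ < 1` (as a nonnegative real via `Finset.sup`)
  set δ : NNReal := (Finset.range a).sup fun i ↦ ‖((coeff i F : 𝓞_ℂ_[p]) : ℂ_[p])‖₊ with hδ
  have hδ1 : (δ : ℝ) < 1 := by
    have : δ < 1 := by
      rw [hδ, Finset.sup_lt_iff (show (⊥ : NNReal) < 1 from zero_lt_one)]
      intro i hi
      have h := hF.2 i (Finset.mem_range.mp hi)
      exact_mod_cast h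
    exact_mod_cast this
  have hδle : ∀ i < a, ‖((coeff i F : 𝓞_ℂ_[p]) : ℂ_[p])‖ ≤ (δ : ℝ) := by
    intro i hi
    have : ‖((coeff i F : 𝓞_ℂ_[p]) : ℂ_[p])‖₊ ≤ δ :=
      Finset.le_sup (f := fun i ↦ ‖((coeff i F : 𝓞_ℂ_[p]) : ℂ_[p])‖₊) (Finset.mem_range.mpr hi)
    exact_mod_cast this
  -- threshold `θ = max(c, δ s) < s`
  set θ : ℝ := max c ((δ : ℝ) * s) with hθ
  have hθs : θ < s := max_lt hcs (by
    calc (δ : ℝ) * s < 1 * s := mul_lt_mul_of_pos_right hδ1 hs0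
      _ = s := one_mul s)
  -- least index `j₀` with `g j₀ > θ`
  have hex : ∃ j, θ < g j := exists_lt_of_lt_ciSup hθs
  set j₀ := Nat.find hex with hj₀
  have hj₀θ : θ < g j₀ := Nat.find_spec hex
  have hmin : ∀ i < j₀, g i ≤ θ := fun i hi ↦ not_lt.mp (Nat.find_min hex hi)
  -- every other term of the coefficient of `F·G` at `a + j₀` has norm `< g j₀`
  have hterm : ∀ i i' : ℕ, i + i' = a + j₀ → (i, i') ≠ (a, j₀) →
      ‖((coeff i F : 𝓞_ℂ_[p]) : ℂ_[p]) * ((coeff i' G : 𝓞_ℂ_[p]) : ℂ_[p])‖ < g j₀ := by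
    intro i i' hsum hne
    rw [norm_mul]
    rcases Nat.lt_trichotomy i a with hi | rfl | hi
    · -- `i < a`: `‖F_i‖ ≤ δ`, `‖G_{i'}‖ ≤ s`
      calc ‖((coeff i F : 𝓞_ℂ_[p]) : ℂ_[p])‖ * ‖((coeff i' G : 𝓞_ℂ_[p]) : ℂ_[p])‖
          ≤ (δ : ℝ) * s := mul_le_mul (hδle i hi) (hle_s i') (hg0 i') δ.2
        _ ≤ θ := le_max_right _ _
        _ < g j₀ := hj₀θ
    · -- `i = a`: then `i' = j₀`, excluded
      exact (hne (Prod.ext rfl (show i' = j₀ by omega))).elim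
    · -- `i > a`: `i' < j₀`, so `‖G_{i'}‖ ≤ θ`
      have hi' : i' < j₀ := by omega
      calc ‖((coeff i F : 𝓞_ℂ_[p]) : ℂ_[p])‖ * ‖((coeff i' G : 𝓞_ℂ_[p]) : ℂ_[p])‖
          ≤ ‖((coeff i' G : 𝓞_ℂ_[p]) : ℂ_[p])‖ :=
            mul_le_of_le_one_left (norm_nonneg _) (norm_coeff_le_one F i)
        _ ≤ θ := hmin i' hi'
        _ < g j₀ := hj₀θ
  -- hence `‖(F·G)_{a+j₀}‖ = g j₀ > c`, a contradiction
  have hmainnorm : ‖((coeff a F : 𝓞_ℂ_[p]) : ℂ_[p]) * ((coeff j₀ G : 𝓞_ℂ_[p]) : ℂ_[p])‖ = g j₀ := by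
    rw [norm_mul, hF.1, one_mul]
  have hcoeff : ‖((coeff (a + j₀) (F * G) : 𝓞_ℂ_[p]) : ℂ_[p])‖ = g j₀ := by
    rw [coe_coeff_mul, ← Finset.add_sum_erase _ _
      (Finset.HasAntidiagonal.mem_antidiagonal.mpr rfl : (a, j₀) ∈ _)]
    have hrest : ‖∑ x ∈ (Finset.HasAntidiagonal.antidiagonal (a + j₀)).erase (a, j₀),
        ((coeff x.1 F : 𝓞_ℂ_[p]) : ℂ_[p]) * ((coeff x.2 G : 𝓞_ℂ_[p]) : ℂ_[p])‖ < g j₀ := by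
      refine norm_sum_lt _ (hc0.trans_lt ((le_max_left c _).trans_lt hj₀θ)) fun x hx ↦ ?_
      obtain ⟨hne, hx⟩ := Finset.mem_erase.mp hx
      rw [Finset.HasAntidiagonal.mem_antidiagonal] at hx
      exact hterm x.1 x.2 hx hne
    rw [IsUltrametricDist.norm_add_eq_max_of_norm_ne_norm (by rw [hmainnorm]; exact hrest.ne'),
      hmainnorm, max_eq_left hrest.le]
  have := hFG (a + j₀)
  rw [hcoeff] at this
  exact absurd ((le_max_left c _).trans_lt hj₀θ) (not_lt.mpr this)

/-- Division of a power series by a constant `c ∈ 𝓞_{ℂ_p}`, `c ≠ 0`, when every coefficient has norm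
`≤ ‖c‖` (`𝓞_{ℂ_p} = {‖·‖ ≤ 1}`). [folklore] -/
theorem exists_eq_C_mul_of_forall_norm_le {G : PowerSeries 𝓞_ℂ_[p]} {c : 𝓞_ℂ_[p]}
    (hc : (c : ℂ_[p]) ≠ 0) (hG : ∀ j, ‖((coeff j G : 𝓞_ℂ_[p]) : ℂ_[p])‖ ≤ ‖(c : ℂ_[p])‖) :
    ∃ G₁ : PowerSeries 𝓞_ℂ_[p], G = C c * G₁ := by
  have hcpos : 0 < ‖(c : ℂ_[p])‖ := norm_pos_iff.mpr hc
  refine ⟨PowerSeries.mk fun j ↦ ⟨((coeff j G : 𝓞_ℂ_[p]) : ℂ_[p]) / c,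
    mem_unitBall.mpr (by rw [norm_div, div_le_one hcpos]; exact hG j)⟩, ?_⟩
  ext j
  rw [PowerSeries.coeff_C_mul, PowerSeries.coeff_mk]
  push_cast
  rw [mul_div_cancel₀ _ hc]

/-- **Cancelling the power of `p`**: if `F` has a unit coefficient and `F · G = p^k · L` in
`𝓞_{ℂ_p}⟦T⟧`, then `F · G' = L` for some `G'` (Gauss: every coefficient of `G` has norm `≤ ‖p‖^k`,
so `G = p^k G'`). [cite: Washington1997, §7.1] -/
theorem exists_mul_eq_of_mul_eq_C_pow_mul {F G L : PowerSeries 𝓞_ℂ_[p]} {a k : ℕ}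
    (hF : (‖((coeff a F : 𝓞_ℂ_[p]) : ℂ_[p])‖ = 1 ∧ ∀ i < a, ‖((coeff i F : 𝓞_ℂ_[p]) : ℂ_[p])‖ < 1))
    (h : F * G = C ((p : 𝓞_ℂ_[p]) ^ k) * L) : ∃ G' : PowerSeries 𝓞_ℂ_[p], F * G' = L := by
  set c : 𝓞_ℂ_[p] := (p : 𝓞_ℂ_[p]) ^ k with hcdef
  have hcC : ((c : 𝓞_ℂ_[p]) : ℂ_[p]) = (p : ℂ_[p]) ^ k := by rw [hcdef]; push_cast; rfl
  have hp0 : (p : ℂ_[p]) ≠ 0 := by exact_mod_cast (Fact.out : p.Prime).ne_zero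
  have hc0 : ((c : 𝓞_ℂ_[p]) : ℂ_[p]) ≠ 0 := by rw [hcC]; exact pow_ne_zero _ hp0
  -- every coefficient of `F·G = C c · L` has norm `≤ ‖c‖`
  have hFG : ∀ m, ‖((coeff m (F * G) : 𝓞_ℂ_[p]) : ℂ_[p])‖ ≤ ‖((c : 𝓞_ℂ_[p]) : ℂ_[p])‖ := by
    intro m
    rw [h, PowerSeries.coeff_C_mul, MulMemClass.coe_mul, norm_mul]
    exact mul_le_of_le_one_right (norm_nonneg _) (norm_coeff_le_one L m)
  obtain ⟨G', rfl⟩ := exists_eq_C_mul_of_forall_norm_le hc0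
    (norm_coeff_le_of_forall_norm_coeff_mul_le hF hFG)
  refine ⟨G', ?_⟩
  have hC0 : (C c : PowerSeries 𝓞_ℂ_[p]) ≠ 0 := by
    intro h0
    have := congrArg constantCoeff h0
    simp only [map_zero, constantCoeff_C] at this
    exact hc0 (by rw [this]; rfl)
  apply mul_left_cancel₀ hC0
  calc C c * (F * G') = F * (C c * G') := by ring
    _ = C c * L := h

/-! ### Equal first unit coefficients + one divisibility ⟹ equal ideals -/

/-- **Unit cofactor**: if `F` and `L = F · G'` have their first unit coefficient at the SAME index,
then `G'` has a unit constant term, hence is a unit of `𝓞_{ℂ_p}⟦T⟧`, and `(F) = (L)`.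
[cite: Washington1997, §7.1] -/
theorem span_singleton_eq_of_firstUnitCoeffAt {F G' L : PowerSeries 𝓞_ℂ_[p]} {n : ℕ}
    (hF : (‖((coeff n F : 𝓞_ℂ_[p]) : ℂ_[p])‖ = 1 ∧ ∀ i < n, ‖((coeff i F : 𝓞_ℂ_[p]) : ℂ_[p])‖ < 1))
    (hL : (‖((coeff n L : 𝓞_ℂ_[p]) : ℂ_[p])‖ = 1 ∧ ∀ i < n, ‖((coeff i L : 𝓞_ℂ_[p]) : ℂ_[p])‖ < 1))
    (h : F * G' = L) :
    Ideal.span ({F} : Set (PowerSeries 𝓞_ℂ_[p])) = Ideal.span {L} := by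
  obtain ⟨b, hb, hab⟩ := exists_firstUnitCoeffAt_right hF
    (h ▸ hL : (‖((coeff n (F * G') : 𝓞_ℂ_[p]) : ℂ_[p])‖ = 1 ∧
      ∀ i < n, ‖((coeff i (F * G') : 𝓞_ℂ_[p]) : ℂ_[p])‖ < 1))
  obtain rfl : b = 0 := by omega
  have hunit : IsUnit G' := by
    rw [PowerSeries.isUnit_iff_constantCoeff]
    refine X11b.isUnit_padicComplexInt_of_norm_eq_one ?_
    rw [← coeff_zero_eq_constantCoeff_apply]
    exact hb.1
  rw [← h, Ideal.span_singleton_mul_right_unit hunit]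

/-- **ONE divisibility after inverting `p` (`p^k · L ∈ (F)`), plus first unit coefficients of `F`
and `L` at the same index, give the EQUALITY of ideals `(F) = (L)` in `𝓞_{ℂ_p}⟦T⟧`** — the
wide-receptacle twin of `X1.KellerYinHalves.span_singleton_eq_of_C_pow_mul_mem` (p406792). Used with
the roles of `F`, `L` in either order: Kolyvagin's "`𝓕 ∣ p^k L`" (c3♭-div) or the Hida limit's
"`L ∣ p^a 𝓕`" (`HidaLimitRevDivOnTree`'s ♭ twin), each + Keller–Yin D′. [cite: Washington1997, §7.1] -/
theorem span_singleton_eq_of_C_pow_mul_mem {F L : PowerSeries 𝓞_ℂ_[p]} {k n : ℕ}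
    (hdiv : C ((p : 𝓞_ℂ_[p]) ^ k) * L ∈ Ideal.span ({F} : Set (PowerSeries 𝓞_ℂ_[p])))
    (hF : (‖((coeff n F : 𝓞_ℂ_[p]) : ℂ_[p])‖ = 1 ∧ ∀ i < n, ‖((coeff i F : 𝓞_ℂ_[p]) : ℂ_[p])‖ < 1))
    (hL : (‖((coeff n L : 𝓞_ℂ_[p]) : ℂ_[p])‖ = 1 ∧ ∀ i < n, ‖((coeff i L : 𝓞_ℂ_[p]) : ℂ_[p])‖ < 1)) :
    Ideal.span ({F} : Set (PowerSeries 𝓞_ℂ_[p])) = Ideal.span {L} := by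
  obtain ⟨G, hG⟩ := Ideal.mem_span_singleton'.mp hdiv
  obtain ⟨G', hG'⟩ := exists_mul_eq_of_mul_eq_C_pow_mul hF (by rw [← hG, mul_comm])
  exact span_singleton_eq_of_firstUnitCoeffAt hF hL hG'

end Summit.BirchSwinnertonDyer.Rank1Residual.X2.CpIntSeries

end
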